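import Mathlib
import Summits.ValiantsHypothesis.ValiantsHypothesis.Theorems.NewtonUnitEquationsTwoProductsPlanarCellSingleRelationTFree
import HarnessLib

/-!
# Crux `TwoProducts` (stmt-ValiantsHypothesis-5906), planar cells with FEW relation classes: preliminaries
# (fibre transport along a block; the family bound from a coefficient formula with constants)

Helper mode (`--supports stmt-ValiantsHypothesis-5906 --as helper`; val-lit-p3 g14, KEEP lineage).  Toward the `t`-free
FEW-RELATION-CLASSES law (`…PlanarCellRelationClasses.lean`), which generalises rung R1 of `Cruxes/TwoProducts/Lines/relation_ladder.lean`
from ONE primitive relation class to `r` classes with arbitrary (possibly overlapping) supports.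

* `fibre_transport`: if two letter tuples `x, y ∈ ∏(A_j ∪ {0})` agree on a block `B` and every tuple with the point of `x`
  (resp. `y`) agrees with `x` (resp. `y`) OFF `B`, then the fibre sum of any letter product `∏ h_i` over the fibre of `y` is
  `(Σ_{fibre(x)} ∏_{i∈B} h_i) · ∏_{i∉B} h_i(y_i)` — the fibres correspond by splicing `B`-parts.  Hence
  `exists_coeff_tailDiff_of_Bagree`: the coefficient of `W` at such `y` is `cF·F_offB(y) − cG·G_offB(y)` with constants read off `x`.
* `card_family_le_of_coeff`: a sub-family `G` of one cell whose representations AND their one/two-letter upgrades by members' letters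
  all obey one such formula (block `B`, constants `cF, cG`) has `#G ≤ 2(m+1)` (`card_le_of_superset_const` in the two classes).
Honest framing: helper lemmas outside any cone of the OPEN crux line; the residual, `PlanarCellBound`, the crux `TwoProducts` and
`VP ≠ VNP` are OPEN and NOT claimed.  No instances, no notation, no named facts. [folklore]
-/

noncomputable section

-- Sub = Summit single-conjunct layout: the duplicated namespace component is mandated by the tree.
set_option linter.dupNamespace false

open scoped BigOperators
open MvPolynomial
open Summit.ValiantsHypothesis.ValiantsHypothesis.Theorems.NewtonUnitEquations.TwoProducts.FormalLogLinearisation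

namespace Summit.ValiantsHypothesis.ValiantsHypothesis.Theorems.NewtonUnitEquations.TwoProducts.PlanarCell

variable {m : ℕ}

/-! ## Fibre transport along a block -/

/-- **FIBRE TRANSPORT.**  Let `x, y ∈ ∏(A_j ∪ {0})` agree on the block `B`, and suppose every tuple with the point of `x` agrees
with `x` off `B`, and likewise for `y`.  Then for any letter product `∏_i h_i`, the fibre sum at the point of `y` equals the
`B`-part fibre sum at the point of `x` times the off-`B` product of `y`. [folklore] -/
theorem fibre_transport (A : Fin m → Finset Expo) (B : Finset (Fin m)) (h : Fin m → Expo → ℂ)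
    {x y : Fin m → Expo} (hx : x ∈ tuples A) (hy : y ∈ tuples A) (hxy : ∀ i ∈ B, y i = x i)
    (Hx : ∀ b ∈ tuples A, ∑ i, b i = ∑ i, x i → ∀ i, i ∉ B → b i = x i)
    (Hy : ∀ b ∈ tuples A, ∑ i, b i = ∑ i, y i → ∀ i, i ∉ B → b i = y i) :
    ∑ b ∈ (tuples A).filter (fun b => ∑ i, b i = ∑ i, y i), ∏ i, h i (b i) =
      (∑ b ∈ (tuples A).filter (fun b => ∑ i, b i = ∑ i, x i), ∏ i ∈ B, h i (b i)) *
        ∏ i, (if i ∈ B then 1 else h i (y i)) := by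
  classical
  set PF := tuples A with hPF
  have hPF' : PF = Fintype.piFinset (fun j => insert (0 : Expo) (A j)) := rfl
  -- splicing
  let φ : (Fin m → Expo) → (Fin m → Expo) := fun b i => if i ∈ B then b i else y i
  let ψ : (Fin m → Expo) → (Fin m → Expo) := fun b i => if i ∈ B then b i else x i
  -- block sums inside a fibre
  have hblock : ∀ (z : Fin m → Expo) (b : Fin m → Expo), ∑ i, b i = ∑ i, z i → (∀ i, i ∉ B → b i = z i) →
      ∑ i ∈ B, b i = ∑ i ∈ B, z i := by
    intro z b hsum hoff
    rw [sum_eq_sum_block_add_sum_off b B, sum_eq_sum_block_add_sum_off z B] at hsum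
    have hrest : ∑ i ∈ Finset.univ.filter (fun i => i ∉ B), b i = ∑ i ∈ Finset.univ.filter (fun i => i ∉ B), z i :=
      Finset.sum_congr rfl fun i hi => hoff i (Finset.mem_filter.1 hi).2
    rw [hrest] at hsum
    exact add_right_cancel hsum
  have hBxy : ∑ i ∈ B, y i = ∑ i ∈ B, x i := Finset.sum_congr rfl fun i hi => hxy i hi
  rw [Finset.sum_mul]
  symm
  refine Finset.sum_nbij' φ ψ ?_ ?_ ?_ ?_ ?_
  · -- `φ` maps the fibre of `x` into the fibre of `y`
    intro b hb
    rw [Finset.mem_filter] at hb ⊢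
    obtain ⟨hbPF, hbsum⟩ := hb
    have hoff := Hx b hbPF hbsum
    refine ⟨?_, ?_⟩
    · rw [hPF', Fintype.mem_piFinset] at hbPF ⊢
      have hyPF := Fintype.mem_piFinset.1 (hPF' ▸ hy)
      intro i
      by_cases hi : i ∈ B
      · simp only [φ, if_pos hi]; exact hbPF i
      · simp only [φ, if_neg hi]; exact hyPF i
    · rw [sum_eq_sum_block_add_sum_off (φ b) B, sum_eq_sum_block_add_sum_off y B]
      have e1 : ∑ i ∈ B, φ b i = ∑ i ∈ B, b i := Finset.sum_congr rfl fun i hi => by simp only [φ, if_pos hi]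
      have e2 : ∑ i ∈ Finset.univ.filter (fun i => i ∉ B), φ b i = ∑ i ∈ Finset.univ.filter (fun i => i ∉ B), y i :=
        Finset.sum_congr rfl fun i hi => by simp only [φ, if_neg (Finset.mem_filter.1 hi).2]
      rw [e1, e2, hblock x b hbsum hoff, ← hBxy]
  · -- `ψ` maps the fibre of `y` into the fibre of `x`
    intro b hb
    rw [Finset.mem_filter] at hb ⊢
    obtain ⟨hbPF, hbsum⟩ := hb
    have hoff := Hy b hbPF hbsum
    refine ⟨?_, ?_⟩
    · rw [hPF', Fintype.mem_piFinset] at hbPF ⊢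
      have hxPF := Fintype.mem_piFinset.1 (hPF' ▸ hx)
      intro i
      by_cases hi : i ∈ B
      · simp only [ψ, if_pos hi]; exact hbPF i
      · simp only [ψ, if_neg hi]; exact hxPF i
    · rw [sum_eq_sum_block_add_sum_off (ψ b) B, sum_eq_sum_block_add_sum_off x B]
      have e1 : ∑ i ∈ B, ψ b i = ∑ i ∈ B, b i := Finset.sum_congr rfl fun i hi => by simp only [ψ, if_pos hi]
      have e2 : ∑ i ∈ Finset.univ.filter (fun i => i ∉ B), ψ b i = ∑ i ∈ Finset.univ.filter (fun i => i ∉ B), x i :=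
        Finset.sum_congr rfl fun i hi => by simp only [ψ, if_neg (Finset.mem_filter.1 hi).2]
      rw [e1, e2, hblock y b hbsum hoff, hBxy]
  · -- `ψ ∘ φ = id` on the fibre of `x`
    intro b hb
    rw [Finset.mem_filter] at hb
    have hoff := Hx b hb.1 hb.2
    funext i
    by_cases hi : i ∈ B
    · simp only [ψ, φ, if_pos hi]
    · simp only [ψ, if_neg hi]; exact (hoff i hi).symm
  · -- `φ ∘ ψ = id` on the fibre of `y`
    intro b hb
    rw [Finset.mem_filter] at hb
    have hoff := Hy b hb.1 hb.2
    funext i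
    by_cases hi : i ∈ B
    · simp only [φ, ψ, if_pos hi]
    · simp only [φ, if_neg hi]; exact (hoff i hi).symm
  · -- the summand
    intro b _
    rw [prod_eq_prod_block_mul_prod_off h (φ b) B]
    congr 1
    · exact Finset.prod_congr rfl fun i hi => by simp only [φ, if_pos hi]
    · exact Finset.prod_congr rfl fun i _ => by
        by_cases hi : i ∈ B
        · simp only [if_pos hi]
        · simp only [if_neg hi, φ]

/-- **COEFFICIENTS WITH CONSTANTS ALONG A BLOCK.**  Fix `x ∈ ∏(A_j ∪ {0})` all of whose point-mates agree with it off `B`.  There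
are constants `cF, cG` such that for every `y` agreeing with `x` on `B`, all of whose point-mates agree with it off `B`, the
coefficient of `W = ∏(1+u_j) − ∏(1+v_j)` at `Σ y` is `cF·∏_{i∉B} û_i(y_i) − cG·∏_{i∉B} v̂_i(y_i)`. [folklore] -/
theorem exists_coeff_tailDiff_of_Bagree (u v : Fin m → MvPolynomial (Fin 2) ℂ) (A : Fin m → Finset Expo)
    (hA0 : ∀ j, (0 : Expo) ∉ A j) (huA : ∀ j, (u j).support ⊆ A j) (hvA : ∀ j, (v j).support ⊆ A j)
    (B : Finset (Fin m)) {x : Fin m → Expo} (hx : x ∈ tuples A)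
    (Hx : ∀ b ∈ tuples A, ∑ i, b i = ∑ i, x i → ∀ i, i ∉ B → b i = x i) :
    ∃ cF cG : ℂ, ∀ y ∈ tuples A, (∀ i ∈ B, y i = x i) →
      (∀ b ∈ tuples A, ∑ i, b i = ∑ i, y i → ∀ i, i ∉ B → b i = y i) →
      coeff (∑ i, y i) (tailDiff u v) =
        cF * ∏ i, (if i ∈ B then 1 else hatCoeff (u i) (y i)) - cG * ∏ i, (if i ∈ B then 1 else hatCoeff (v i) (y i)) := by
  classical
  refine ⟨∑ b ∈ (tuples A).filter (fun b => ∑ i, b i = ∑ i, x i), ∏ i ∈ B, hatCoeff (u i) (b i),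
    ∑ b ∈ (tuples A).filter (fun b => ∑ i, b i = ∑ i, x i), ∏ i ∈ B, hatCoeff (v i) (b i), ?_⟩
  intro y hy hyx Hy
  have hW : tailDiff u v = ∏ j, (1 + u j) - ∏ j, (1 + v j) := rfl
  rw [hW, coeff_sub, coeff_prod_one_add_eq_fibreSum u A hA0 huA, coeff_prod_one_add_eq_fibreSum v A hA0 hvA]
  have hF := fibre_transport A B (fun i e => hatCoeff (u i) e) hx hy hyx Hx Hy
  have hG := fibre_transport A B (fun i e => hatCoeff (v i) e) hx hy hyx Hx Hy
  have hPF' : (Fintype.piFinset fun j => insert (0 : Expo) (A j)) = tuples A := rfl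
  rw [hPF', hF, hG]

/-! ## A family obeying one coefficient formula has at most `2(m+1)` points -/

/-- **FAMILY BOUND FROM A COEFFICIENT FORMULA.**  One cell (`S`, cell weight `ζ`), representations `rep` with letters in
`tailSupport ∪ {0}`; a sub-family `G ⊆ S`, a block `B` and constants `cF, cG` such that the coefficient of `W` at the point of
every representation of a member of `G` (`hcoef0`), and of every upgrade of it at one or two positions by letters of members of
`G` (`hcoefUp`), is `cF·∏_{i∉B} û_i − cG·∏_{i∉B} v̂_i` of its letters.  Then `#G ≤ 2(m+1)`. [folklore] -/
theorem card_family_le_of_coeff (u v : Fin m → MvPolynomial (Fin 2) ℂ) (A : Fin m → Finset Expo)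
    (hA0 : ∀ j, (0 : Expo) ∉ A j) (huA : ∀ j, (u j).support ⊆ A j) (hvA : ∀ j, (v j).support ⊆ A j)
    (R : Expo → Expo → Prop) (S : Finset Expo)
    (hS : ∀ l ∈ S, ∃ ξ : Fin 2 → ℝ, ValidWeight u v ξ ∧ IsStrictTop ξ (logSupport u v) l ∧
      ∀ e ∈ tailSupport u v, ∀ e' ∈ tailSupport u v, (R e e' ↔ wt ξ e ≤ wt ξ e'))
    (ζ : Fin 2 → ℝ) (hζval : ValidWeight u v ζ)
    (hRζ : ∀ e ∈ tailSupport u v, ∀ e' ∈ tailSupport u v, (R e e' ↔ wt ζ e ≤ wt ζ e'))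
    (rep : Expo → Fin m → Expo) (hrepsum : ∀ l ∈ S, ∑ j, rep l j = l)
    (hrepT : ∀ l ∈ S, ∀ i, rep l i = 0 ∨ rep l i ∈ tailSupport u v)
    (G : Finset Expo) (hGS : G ⊆ S) (B : Finset (Fin m)) (cF cG : ℂ)
    (hcoef0 : ∀ l ∈ G, coeff (∑ i, rep l i) (tailDiff u v) =
      cF * ∏ i, (if i ∈ B then 1 else hatCoeff (u i) (rep l i)) - cG * ∏ i, (if i ∈ B then 1 else hatCoeff (v i) (rep l i)))
    (hcoefUp : ∀ l ∈ G, ∀ l₁ ∈ G, ∀ l₂ ∈ G, ∀ (j j' : Fin m) (y : Fin m → Expo),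
      (y = Function.update (rep l) j (rep l₁ j) ∨ y = Function.update (rep l) j' (rep l₂ j') ∨
          y = Function.update (Function.update (rep l) j (rep l₁ j)) j' (rep l₂ j')) →
        coeff (∑ i, y i) (tailDiff u v) =
          cF * ∏ i, (if i ∈ B then 1 else hatCoeff (u i) (y i)) - cG * ∏ i, (if i ∈ B then 1 else hatCoeff (v i) (y i))) :
    G.card ≤ 2 * (m + 1) := by
  classical
  set T := tailSupport u v with hT
  have hGS' : ∀ l ∈ G, l ∈ S := fun l hl => hGS hl
  set f : Fin m → Expo → ℂ := fun i e => if i ∈ B then 1 else hatCoeff (u i) e with hf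
  set g : Fin m → Expo → ℂ := fun i e => if i ∈ B then 1 else hatCoeff (v i) e with hg
  have hcoef0' : ∀ l ∈ G, coeff (∑ i, rep l i) (tailDiff u v) = cF * ∏ i, f i (rep l i) - cG * ∏ i, g i (rep l i) :=
    fun l hl => by rw [hcoef0 l hl]
  have hcoefUp' : ∀ l ∈ G, ∀ l₁ ∈ G, ∀ l₂ ∈ G, ∀ (j j' : Fin m) (y : Fin m → Expo),
      (y = Function.update (rep l) j (rep l₁ j) ∨ y = Function.update (rep l) j' (rep l₂ j') ∨
          y = Function.update (Function.update (rep l) j (rep l₁ j)) j' (rep l₂ j')) →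
        coeff (∑ i, y i) (tailDiff u v) = cF * ∏ i, f i (y i) - cG * ∏ i, g i (y i) :=
    fun l hl l₁ hl₁ l₂ hl₂ j j' y hy => by rw [hcoefUp l hl l₁ hl₁ l₂ hl₂ j j' y hy]
  -- general cell facts
  have hu0 : ∀ j, coeff 0 (u j) = 0 := fun j => notMem_support_iff.1 fun h => hA0 j (huA j h)
  have hv0 : ∀ j, coeff 0 (v j) = 0 := fun j => notMem_support_iff.1 fun h => hA0 j (hvA j h)
  choose! ξ hval htop hRξ using hS
  have htopW : ∀ l ∈ S, IsStrictTop (ξ l) ↑(tailDiff u v).support l := fun l hl =>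
    (stub_logLinearisation m u v hu0 hv0 (ξ l) (hval l hl) l).2 (htop l hl)
  have hsupp : ∀ l ∈ S, l ∈ (tailDiff u v).support := fun l hl => (htopW l hl).1
  have hwt0 : ∀ (η : Fin 2 → ℝ), wt η 0 = 0 := fun η => by simp [wt]
  have hval_neg : ∀ l ∈ S, ∀ e ∈ T, wt (ξ l) e < 0 := by
    intro l hl e he
    rcases Finset.mem_union.1 he with h | h
    · obtain ⟨j, -, hj⟩ := Finset.mem_biUnion.1 h
      exact (hval l hl).1 j e hj
    · obtain ⟨j, -, hj⟩ := Finset.mem_biUnion.1 h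
      exact (hval l hl).2 j e hj
  have hζ_neg : ∀ e ∈ T, wt ζ e < 0 := by
    intro e he
    rcases Finset.mem_union.1 he with h | h
    · obtain ⟨j, -, hj⟩ := Finset.mem_biUnion.1 h
      exact hζval.1 j e hj
    · obtain ⟨j, -, hj⟩ := Finset.mem_biUnion.1 h
      exact hζval.2 j e hj
  have transfer : ∀ l ∈ S, ∀ p q : Expo, (p = 0 ∨ p ∈ T) → (q = 0 ∨ q ∈ T) →
      wt ζ q ≤ wt ζ p → wt (ξ l) q ≤ wt (ξ l) p := by
    intro l hl p q hp hq hle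
    rcases hp with rfl | hp
    · rcases hq with rfl | hq
      · exact le_rfl
      · rw [hwt0]; exact (hval_neg l hl q hq).le
    · rcases hq with rfl | hq
      · exfalso
        rw [hwt0] at hle
        linarith [hζ_neg p hp]
      · exact (hRξ l hl q hq p hp).1 ((hRζ q hq p hp).2 hle)
  have stransfer : ∀ l ∈ S, ∀ p q : Expo, (p = 0 ∨ p ∈ T) → (q = 0 ∨ q ∈ T) →
      wt ζ q < wt ζ p → wt (ξ l) q < wt (ξ l) p := by
    intro l hl p q hp hq hlt
    rcases hp with rfl | hp
    · rcases hq with rfl | hq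
      · exact absurd hlt (lt_irrefl _)
      · rw [hwt0]; exact hval_neg l hl q hq
    · rcases hq with rfl | hq
      · exfalso
        rw [hwt0] at hlt
        linarith [hζ_neg p hp]
      · by_contra hle
        have h1 : wt ζ p ≤ wt ζ q := (hRζ p hp q hq).1 ((hRξ l hl p hp q hq).2 (not_lt.1 hle))
        exact absurd hlt (not_lt.2 h1)
  have hwt_rep : ∀ (η : Fin 2 → ℝ), ∀ l ∈ S, wt η l = ∑ j, wt η (rep l j) := by
    intro η l hl
    conv_lhs => rw [← hrepsum l hl]
    exact wt_sum η _ _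
  -- cancellation
  have hcancel0 : ∀ l ∈ S, ∀ a' : Fin m → Expo, (∀ i, a' i = 0 ∨ a' i ∈ T) → (∀ i, wt ζ (rep l i) ≤ wt ζ (a' i)) →
      (∃ i, wt ζ (rep l i) < wt ζ (a' i)) → coeff (∑ j, a' j) (tailDiff u v) = 0 := by
    intro l hl a' hT' hle ⟨i₀, hi₀⟩
    have hgt : wt (ξ l) l < wt (ξ l) (∑ j, a' j) := by
      rw [hwt_rep (ξ l) l hl, wt_sum]
      refine Finset.sum_lt_sum (fun i _ => transfer l hl (a' i) (rep l i) (hT' i) (hrepT l hl i) (hle i)) ?_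
      exact ⟨i₀, Finset.mem_univ _, stransfer l hl (a' i₀) (rep l i₀) (hT' i₀) (hrepT l hl i₀) hi₀⟩
    by_contra h
    have hmem : (∑ j, a' j) ∈ ((tailDiff u v).support : Set Expo) := mem_support_iff.2 h
    have hne : (∑ j, a' j) ≠ l := fun heq => by rw [heq] at hgt; exact lt_irrefl _ hgt
    have := (htopW l hl).2 _ hmem hne
    exact absurd hgt (not_lt.2 this.le)
  -- letterwise non-domination inside `S`
  have hnodom0 : ∀ l ∈ S, ∀ l' ∈ S, l ≠ l' → ∃ j, wt ζ (rep l j) < wt ζ (rep l' j) := by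
    intro l hl l' hl' hne
    by_contra hno
    push Not at hno
    have hge : wt (ξ l') l' ≤ wt (ξ l') l := by
      rw [hwt_rep (ξ l') l hl, hwt_rep (ξ l') l' hl']
      exact Finset.sum_le_sum fun i _ => transfer l' hl' (rep l i) (rep l' i) (hrepT l hl i) (hrepT l' hl' i) (hno i)
    have := (htopW l' hl').2 l (hsupp l hl) hne
    exact absurd hge (not_le.2 this)
  -- upgrades inside the family are cancelled
  have hcancelAll : ∀ l ∈ G, ∀ l₁ ∈ G, ∀ l₂ ∈ G, ∀ j j' : Fin m, j ≠ j' →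
      wt ζ (rep l j) < wt ζ (rep l₁ j) → wt ζ (rep l j') < wt ζ (rep l₂ j') →
      ∀ a' : Fin m → Expo, (a' = Function.update (rep l) j (rep l₁ j) ∨ a' = Function.update (rep l) j' (rep l₂ j') ∨
          a' = Function.update (Function.update (rep l) j (rep l₁ j)) j' (rep l₂ j')) →
        cF * ∏ i, f i (a' i) = cG * ∏ i, g i (a' i) := by
    intro l hl l₁ hl₁ l₂ hl₂ j j' hjj hj hj' a' ha'
    have hlS := hGS' l hl; have hl₁S := hGS' l₁ hl₁; have hl₂S := hGS' l₂ hl₂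
    have hletters : ∀ i, a' i = rep l i ∨ a' i = rep l₁ i ∨ a' i = rep l₂ i := by
      intro i
      rcases ha' with rfl | rfl | rfl
      · by_cases hi : i = j
        · subst hi; rw [Function.update_self]; exact Or.inr (Or.inl rfl)
        · rw [Function.update_of_ne hi]; exact Or.inl rfl
      · by_cases hi : i = j'
        · subst hi; rw [Function.update_self]; exact Or.inr (Or.inr rfl)
        · rw [Function.update_of_ne hi]; exact Or.inl rfl
      · by_cases hi : i = j'
        · subst hi; rw [Function.update_self]; exact Or.inr (Or.inr rfl)
        · rw [Function.update_of_ne hi]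
          by_cases hi2 : i = j
          · subst hi2; rw [Function.update_self]; exact Or.inr (Or.inl rfl)
          · rw [Function.update_of_ne hi2]; exact Or.inl rfl
    have hle : ∀ i, wt ζ (rep l i) ≤ wt ζ (a' i) := by
      intro i
      rcases ha' with rfl | rfl | rfl
      · by_cases hi : i = j
        · subst hi; rw [Function.update_self]; exact hj.le
        · rw [Function.update_of_ne hi]
      · by_cases hi : i = j'
        · subst hi; rw [Function.update_self]; exact hj'.le
        · rw [Function.update_of_ne hi]
      · by_cases hi : i = j'
        · subst hi; rw [Function.update_self]; exact hj'.le
        · rw [Function.update_of_ne hi]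
          by_cases hi2 : i = j
          · subst hi2; rw [Function.update_self]; exact hj.le
          · rw [Function.update_of_ne hi2]
    have hlt : ∃ i, wt ζ (rep l i) < wt ζ (a' i) := by
      rcases ha' with rfl | rfl | rfl
      · exact ⟨j, by rw [Function.update_self]; exact hj⟩
      · exact ⟨j', by rw [Function.update_self]; exact hj'⟩
      · exact ⟨j', by rw [Function.update_self]; exact hj'⟩
    have hT' : ∀ i, a' i = 0 ∨ a' i ∈ T := by
      intro i
      rcases hletters i with h | h | h <;> rw [h]
      · exact hrepT l hlS i
      · exact hrepT l₁ hl₁S i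
      · exact hrepT l₂ hl₂S i
    have h0 := hcancel0 l hlS a' hT' hle hlt
    rw [hcoefUp' l hl l₁ hl₁ l₂ hl₂ j j' a' ha'] at h0
    exact sub_eq_zero.1 h0
  -- the two classes
  set CF := G.filter fun l => cF * ∏ j, f j (rep l j) ≠ 0 ∧
    cF * ∏ j, f j (rep l j) ≠ cG * ∏ j, g j (rep l j) with hCF
  set CG := G.filter fun l => cG * ∏ j, g j (rep l j) ≠ 0 ∧
    cG * ∏ j, g j (rep l j) ≠ cF * ∏ j, f j (rep l j) with hCG
  have hCFcard : CF.card ≤ m + 1 :=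
    card_le_of_superset_const cF cG f g ζ rep CF
      (fun l hl l' hl' hne => hnodom0 l (hGS' l (Finset.mem_filter.1 hl).1) l' (hGS' l' (Finset.mem_filter.1 hl').1) hne)
      (fun l hl => (Finset.mem_filter.1 hl).2)
      (fun l hl l₁ hl₁ l₂ hl₂ j j' hjj hj hj' a' ha' =>
        hcancelAll l (Finset.mem_filter.1 hl).1 l₁ (Finset.mem_filter.1 hl₁).1 l₂ (Finset.mem_filter.1 hl₂).1
          j j' hjj hj hj' a' ha')
  have hCGcard : CG.card ≤ m + 1 :=
    card_le_of_superset_const cG cF g f ζ rep CG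
      (fun l hl l' hl' hne => hnodom0 l (hGS' l (Finset.mem_filter.1 hl).1) l' (hGS' l' (Finset.mem_filter.1 hl').1) hne)
      (fun l hl => (Finset.mem_filter.1 hl).2)
      (fun l hl l₁ hl₁ l₂ hl₂ j j' hjj hj hj' a' ha' =>
        (hcancelAll l (Finset.mem_filter.1 hl).1 l₁ (Finset.mem_filter.1 hl₁).1 l₂ (Finset.mem_filter.1 hl₂).1
          j j' hjj hj hj' a' ha').symm)
  -- cover
  have hcover : G ⊆ CF ∪ CG := by
    intro l hl
    have hlS := hGS' l hl
    have hne : coeff l (tailDiff u v) ≠ 0 := mem_support_iff.1 (hsupp l hlS)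
    rw [← hrepsum l hlS, hcoef0' l hl] at hne
    rw [Finset.mem_union]
    by_cases hF0 : cF * ∏ j, f j (rep l j) = 0
    · right
      refine Finset.mem_filter.2 ⟨hl, ?_, fun h => hne (by rw [h, sub_self])⟩
      intro hG0; apply hne; rw [hF0, hG0, sub_self]
    · exact Or.inl (Finset.mem_filter.2 ⟨hl, hF0, fun h => hne (by rw [h, sub_self])⟩)
  calc G.card ≤ (CF ∪ CG).card := Finset.card_le_card hcover
    _ ≤ CF.card + CG.card := Finset.card_union_le _ _
    _ ≤ (m + 1) + (m + 1) := Nat.add_le_add hCFcard hCGcard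
    _ = 2 * (m + 1) := by ring

end Summit.ValiantsHypothesis.ValiantsHypothesis.Theorems.NewtonUnitEquations.TwoProducts.PlanarCell

end
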